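import Summits.Ventures.GridStability.Models.InverterBridges
import Summits.Ventures.GridStability.Models.SMIB

/-!
# GridStability/Models/InverterBridgesSMIB — droop / VSM grid-forming inverter ↦ model-1's `SMIB` and its polynomial recast

Cell `gridfusion` (LADDER-GRIDFUSION, rung G3 «inverter models» = APEX LINE by director RULINGS 3 (1),
seat model-3; `plan/PARTITION.md` §0 row `Models/`, amendments A1 (deviation-coordinate recast,
REDEFINED rational equilibrium data) and A12 (second typist IMPORTS)). THREE COLUMNS: this file is
MODELLED-column bookkeeping between typed models. It proves IDENTITIES OF VECTOR FIELDS and the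
CHAIN RULE along solutions — no approximation, no stability claim about any converter or grid.

## What is bridged

* The reduced droop-controlled («Strategy C», no PLL) converter-vs-infinite-bus model
  `InverterDroop.ReducedParams` ([cite: Qoria2020, eq. (III-46) with (V-13)–(V-14)]) with
  `ω_set = ω_e`, read in the speed deviation `Ω = ω_b (ω − ω_e)` [rad/s], IS model-1's classical
  single-machine–infinite-bus record `Models.SMIB` (Anderson–Fouad (2.41)–(2.42) + damping,
  `Models/SMIB.lean`) with
  `M = 1/(k_i ω_c)`, `D = 1/k_i`, `P_m = p*`, `P_C = 0`, `P_M = P_max`, `γ = 0`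
  — the swing-equation identification [cite: Qoria2020, eqs. (III-21)–(III-22)],
  [cite: SchifferEtAl2014, Remark 3.3]. Vector fields agree pointwise (`toGridSMIB_field`),
  solutions are carried to solutions (`isSolutionOn_toGridSMIB`), equilibria coincide
  (`isEquilibrium_toGridSMIB_iff`).
* CONSEQUENTLY model-1's POLYNOMIAL RECAST applies verbatim: in the deviation variables
  `z = (σ, κ, Ω) = (sin(δ − δ^s), 1 − cos(δ − δ^s), Ω)` the droop inverter obeys
  `SMIB.polyField a b d` with the DROOP-NATIVE rational data
  `a = k_i ω_c P_max cos δ^s`, `b = k_i ω_c P_max sin δ^s` (`= k_i ω_c p*`), `d = ω_c`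
  (`toGridSMIB_a/_b/_d`: the A1 relations of `Models/SMIB.lean` rewritten in converter gains — the
  recast damping rate IS the power-filter cut-off `ω_c`), on the constraint `SMIB.hcon = 0`, and
  every solution of the reduced droop model is carried to a curve whose recast coordinates satisfy
  `dz_k/dt = f_k(z)` (`hasDerivWithinAt_embed`, the chain rule = model-1's
  `SMIB.hasDerivWithinAt_embed` transported). Hence ANY Bench certificate stated for
  `SMIB.polyField a b d` / `SMIB.hcon` (sos-5's `Bench/SMIB*.lean`, lyap-1's
  `Lyapunov/CertificateSoundness.lean`) with these numbers is, literally, a certificate about the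
  droop-inverter model — the apex line's first rung costs no new pipeline (memo §4/§5).
* Coherence with the OTHER typing of the swing model: the predecessor bridge
  `InverterDroop.ReducedParams.toSMIB` lands in lit-2's printed
  `Literature.MathematicalPhysics.PowerSystems.SMIB` ([cite: SauerPai1998, §9.6.2 (9.30)]); the two
  records have the same vector field and the same energy function (`toSMIB_vectorField_eq_field`,
  `toSMIB_energy_eq_energy`) — so nothing is typed twice (A12).
* §2: the VSM outer loop [cite: HenriquezAuba2022, eqs. (2.59a)–(2.59b)] closed quasi-statically,
  via `VsmOuterLoop.toReduced`, is the `Models.SMIB` record with `M_smib = M/Ω_b`,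
  `D_smib = 1/(Ω_b k_p)` in `Ω = Ω_b(ω − ω_s)`; solutions are carried likewise.

MODELLED: absent effects = those of MODEL-VALIDITY rows MV-6D (droop) / MV-6V (VSM): inner
voltage/current loops, LC(L) filter and line dynamics, dc side, current limitation, voltage-magnitude
dynamics; infinite bus. «Inertia» and «damping» here are CONTROL GAINS (`1/(k_i ω_c)`, `1/k_i`),
not machine physics. No parameter values (model-4 custody).
-/

noncomputable section

open Real
open Literature.Computation.Certificates
open Literature.Computation.Certificates.SOS

namespace Summit.Ventures.GridStability.Models

/-! ## §1 Reduced droop model ↦ `Models.SMIB` (model-1) -/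

namespace InverterDroop.ReducedParams

variable (P : InverterDroop.ReducedParams)

/-- Model-1's classical SMIB record (`Models/SMIB.lean`, Anderson–Fouad (2.41)–(2.42) with damping)
equivalent to the reduced droop-GFM model in the speed deviation `Ω = ω_b(ω − ω_e)` [rad/s]:
`M = 1/(k_i ω_c)`, `D = 1/k_i`, `P_m = p*`, `P_C = 0` (no local load / lossless coupling),
`P_M = P_max`, `γ = 0` [cite: Qoria2020, eqs. (III-21)–(III-22)], [cite: SchifferEtAl2014,
Remark 3.3]. MODELLED: MODEL-VALIDITY MV-6D; absent effects = inner loops, filter/line/dc-side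
dynamics, current limits, voltage dynamics. -/
def toGridSMIB : Models.SMIB where
  M := 1 / (P.ki * P.ωc)
  D := 1 / P.ki
  Pm := P.pref
  PC := 0
  PM := P.Pmax
  γ := 0

/-- The state map `(δ, ω [pu]) ↦ (δ, Ω)` with `Ω = ω_b(ω − ω_e)` [rad/s] (speed deviation from the
infinite bus), under which the reduced droop model becomes `toGridSMIB`. -/
def toGridState (x : ℝ × ℝ) : ℝ × ℝ := (x.1, P.ωb * (x.2 - P.ωe))

/-- First component of the state map is the angle. -/
@[simp] theorem toGridState_fst (x : ℝ × ℝ) : (P.toGridState x).1 = x.1 := rfl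

/-- Second component of the state map is `Ω = ω_b(ω − ω_e)`. -/
@[simp] theorem toGridState_snd (x : ℝ × ℝ) : (P.toGridState x).2 = P.ωb * (x.2 - P.ωe) := rfl

/-- The electrical power of the equivalent SMIB record is the quasi-static converter power
`P_max sin δ` [cite: Qoria2020, eq. (V-13)]. -/
@[simp] theorem toGridSMIB_Pe (δ : ℝ) : P.toGridSMIB.Pe δ = P.Pmax * sin δ := by
  simp [Models.SMIB.Pe, toGridSMIB]

/-- **Vector fields agree.** At the image state `(δ, ω_b(ω − ω_e))` the SMIB field of `toGridSMIB`
is `(ω_b(ω − ω_e), ω_b · dω)` — the push-forward of the reduced droop field `(dδ, dω)` under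
`toGridState` (for `ω_set = ω_e` and nonzero `ω_b, k_i, ω_c`). Identity, no approximation. -/
theorem toGridSMIB_field (hb : P.ωb ≠ 0) (hi : P.ki ≠ 0) (hc : P.ωc ≠ 0) (hω : P.ωset = P.ωe)
    (δ ω : ℝ) :
    P.toGridSMIB.field (δ, P.ωb * (ω - P.ωe)) = (P.dδ δ ω, P.ωb * P.dω δ ω) := by
  simp only [Models.SMIB.field, Models.SMIB.Pe, InverterDroop.ReducedParams.dδ,
    InverterDroop.ReducedParams.dω, InverterDroop.ReducedParams.dωOf, hω]
  refine Prod.ext rfl ?_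
  simp only [toGridSMIB, sub_zero, zero_add]
  field_simp

/-- **Solutions correspond.** Every solution `(δ, ω)` of the reduced droop model (`ω_set = ω_e`)
is carried by `toGridState` to a solution of model-1's `M_smib = toGridSMIB` on every time set `s`
(tree convention `SMIB.IsSolutionOn`: `HasDerivWithinAt` within `s`). -/
theorem isSolutionOn_toGridSMIB (hb : P.ωb ≠ 0) (hi : P.ki ≠ 0) (hc : P.ωc ≠ 0)
    (hω : P.ωset = P.ωe) {δ ω : ℝ → ℝ} (h : P.IsSolution δ ω) (s : Set ℝ) :
    P.toGridSMIB.IsSolutionOn (fun t => P.toGridState (δ t, ω t)) s := by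
  intro t _
  have h1 : HasDerivAt δ (P.dδ (δ t) (ω t)) t := h.angle t
  have h2 : HasDerivAt (fun τ => P.ωb * (ω τ - P.ωe)) (P.ωb * P.dω (δ t) (ω t)) t :=
    ((h.freq t).sub_const P.ωe).const_mul P.ωb
  have h12 := (h1.prodMk h2).hasDerivWithinAt (s := s)
  simpa [toGridState, P.toGridSMIB_field hb hi hc hω] using h12

/-- **Equilibria coincide.** `δ^s` is an equilibrium angle of `toGridSMIB` iff the converter power
balance `P_max sin δ^s = p*` holds [cite: Qoria2020, eq. (V-15)] (cf.
`isEquilibrium_of_sin_eq`, `power_balance_of_isEquilibrium` for the reduced model itself). -/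
theorem isEquilibrium_toGridSMIB_iff (δs : ℝ) :
    P.toGridSMIB.IsEquilibrium δs ↔ P.Pmax * sin δs = P.pref := by
  rw [Models.SMIB.isEquilibrium_iff]
  simp [toGridSMIB]

/-- The reduced model's equilibrium `(δ^s, ω_e)` (with `ω_set = ω_e`, nonzero gains) gives an
equilibrium angle of `toGridSMIB`, and `toGridState (δ^s, ω_e) = (δ^s, 0)`. -/
theorem isEquilibrium_toGridSMIB_of_isEquilibrium (hb : P.ωb ≠ 0) (hi : P.ki ≠ 0) (hc : P.ωc ≠ 0)
    (hω : P.ωset = P.ωe) {δs ω : ℝ} (h : P.IsEquilibrium δs ω) :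
    P.toGridSMIB.IsEquilibrium δs ∧ P.toGridState (δs, ω) = (δs, 0) := by
  refine ⟨(P.isEquilibrium_toGridSMIB_iff δs).2 (P.power_balance_of_isEquilibrium hb hi hc hω h), ?_⟩
  have hωe : ω = P.ωe := P.omega_eq_of_isEquilibrium hb h
  simp [toGridState, hωe]

/-! ### The A1 recast data in converter gains -/

/-- A1 relation `a = P_M cos(δ^s − γ)/M` for `toGridSMIB`: `a = k_i ω_c P_max cos δ^s`. -/
theorem toGridSMIB_a (δs : ℝ) :
    P.toGridSMIB.PM * cos (δs - P.toGridSMIB.γ) / P.toGridSMIB.M = P.ki * P.ωc * P.Pmax * cos δs := by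
  simp only [toGridSMIB, sub_zero]
  field_simp

/-- A1 relation `b = P_M sin(δ^s − γ)/M` for `toGridSMIB`: `b = k_i ω_c P_max sin δ^s`
(`= k_i ω_c p*` at an equilibrium). -/
theorem toGridSMIB_b (δs : ℝ) :
    P.toGridSMIB.PM * sin (δs - P.toGridSMIB.γ) / P.toGridSMIB.M = P.ki * P.ωc * P.Pmax * sin δs := by
  simp only [toGridSMIB, sub_zero]
  field_simp

/-- A1 relation `d = D/M` for `toGridSMIB`: the recast damping rate is the POWER-FILTER CUT-OFF,
`d = ω_c` (for `k_i ≠ 0`). -/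
theorem toGridSMIB_d (hi : P.ki ≠ 0) : P.toGridSMIB.D / P.toGridSMIB.M = P.ωc := by
  simp only [toGridSMIB]
  field_simp

/-- `toGridSMIB.M ≠ 0` for nonzero gains. -/
theorem toGridSMIB_M_ne_zero (hi : P.ki ≠ 0) (hc : P.ωc ≠ 0) : P.toGridSMIB.M ≠ 0 := by
  simp only [toGridSMIB]
  exact one_div_ne_zero (mul_ne_zero hi hc)

/-! ### The polynomial recast, transported (interface I2 for the inverter rung) -/

/-- The recast constraint `h(z) = σ² + κ² − 2κ = 0` holds identically along the image of any
droop state: `SMIB.hcon.eval (SMIB.embed δ^s (toGridState x)) = 0` (model-1's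
`hcon_eval_embed`, restated for the inverter state map). -/
theorem hcon_eval_embed (δs : ℝ) (x : ℝ × ℝ) :
    Models.SMIB.hcon.eval (Models.SMIB.embed δs (P.toGridState x)) = 0 :=
  Models.SMIB.hcon_eval_embed δs _

/-- The equilibrium `(δ^s, ω_e)` of the reduced droop model is mapped to the origin `z = 0` of the
recast variables. -/
theorem embed_equilibrium (δs : ℝ) (k : ℕ) :
    Models.SMIB.embed δs (P.toGridState (δs, P.ωe)) k = 0 := by
  have : P.toGridState (δs, P.ωe) = (δs, 0) := by simp [toGridState]
  rw [this]
  exact Models.SMIB.embed_equilibrium δs k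

/-- **Exact embedding lemma for the droop inverter (chain rule).** Let the rational recast data
satisfy the droop-native A1 relations `a = k_i ω_c P_max cos δ^s`, `b = k_i ω_c P_max sin δ^s`,
`d = ω_c`, let `δ^s` be an equilibrium angle (`P_max sin δ^s = p*`, i.e. the REDEFINED `p*′` of
A1 when `(sin δ^s, cos δ^s)` is a rational circle point), `ω_set = ω_e`, gains nonzero. Then along
every solution `(δ, ω)` of the reduced droop model, the recast curve
`t ↦ z(t) = SMIB.embed δ^s (δ t, ω_b(ω t − ω_e))` satisfies `dz_k/dt = f_k(z(t))` within any time
set `s`, `f = SMIB.polyField a b d`, for `k = 0, 1, 2`. So for any polynomial `V`,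
`d/dt V(z(t)) = (∇V·f)(z(t))` on `{h = 0}` — exactly the quantity sos-5's SMIB Bench certificates
bound; with these `(a, b, d)` such a certificate is a certificate about the droop-inverter MODEL.
MODELLED: MV-6D. -/
theorem hasDerivWithinAt_embed (hb : P.ωb ≠ 0) (hi : P.ki ≠ 0) (hc : P.ωc ≠ 0)
    (hω : P.ωset = P.ωe) {a b d : ℚ} {δs : ℝ}
    (ha : (a : ℝ) = P.ki * P.ωc * P.Pmax * cos δs) (hb' : (b : ℝ) = P.ki * P.ωc * P.Pmax * sin δs)
    (hd : (d : ℝ) = P.ωc) (hP : P.Pmax * sin δs = P.pref)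
    {δ ω : ℝ → ℝ} (h : P.IsSolution δ ω) {s : Set ℝ} {t : ℝ} (ht : t ∈ s) (k : Fin 3) :
    HasDerivWithinAt (fun τ => Models.SMIB.embed δs (P.toGridState (δ τ, ω τ)) k)
      (((Models.SMIB.polyField a b d).getD k []).eval
        (Models.SMIB.embed δs (P.toGridState (δ t, ω t)))) s t := by
  have hM := P.toGridSMIB_M_ne_zero hi hc
  have ha' : (a : ℝ) = P.toGridSMIB.PM * cos (δs - P.toGridSMIB.γ) / P.toGridSMIB.M := by
    rw [P.toGridSMIB_a, ha]
  have hb'' : (b : ℝ) = P.toGridSMIB.PM * sin (δs - P.toGridSMIB.γ) / P.toGridSMIB.M := by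
    rw [P.toGridSMIB_b, hb']
  have hd' : (d : ℝ) = P.toGridSMIB.D / P.toGridSMIB.M := by rw [P.toGridSMIB_d hi, hd]
  have hP' : P.toGridSMIB.IsEquilibrium δs := (P.isEquilibrium_toGridSMIB_iff δs).2 hP
  exact P.toGridSMIB.hasDerivWithinAt_embed hM ha' hb'' hd' hP'
    (P.isSolutionOn_toGridSMIB hb hi hc hω h s) ht k

/-! ### Coherence with lit-2's printed SMIB (`InverterBridges.toSMIB`) -/

/-- The two SMIB typings reached from the droop model have THE SAME vector field: lit-2's
`Literature.MathematicalPhysics.PowerSystems.SMIB.vectorField` of `P.toSMIB`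
([cite: SauerPai1998, §9.6.2 (9.30)]) equals model-1's `Models.SMIB.field` of `P.toGridSMIB`
(Anderson–Fouad (2.42)) at every state. -/
theorem toSMIB_vectorField_eq_field (x : ℝ × ℝ) :
    P.toSMIB.vectorField x = P.toGridSMIB.field x := by
  simp [Literature.MathematicalPhysics.PowerSystems.SMIB.vectorField,
    Literature.MathematicalPhysics.PowerSystems.SMIB.accel, Models.SMIB.field, Models.SMIB.Pe,
    toSMIB, toGridSMIB]

/-- … and THE SAME energy function: Sauer–Pai (9.35) `½MΩ² + V_PE` of `P.toSMIB` equals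
model-1's `Models.SMIB.energy` of `P.toGridSMIB` (A–F §2.8 energy integral), for every datum
`δ^s` and state. Hence `InverterBridges.hasDerivAt_energy` (`dV/dt = −(1/k_i)Ω²`) is a statement
about either record. -/
theorem toSMIB_energy_eq_energy (δs : ℝ) (x : ℝ × ℝ) :
    P.toSMIB.energy δs x = P.toGridSMIB.energy δs x := by
  simp only [Literature.MathematicalPhysics.PowerSystems.SMIB.energy,
    Literature.MathematicalPhysics.PowerSystems.SMIB.potentialEnergy, Models.SMIB.energy, toSMIB,
    toGridSMIB, sub_zero]
  ring

end InverterDroop.ReducedParams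

/-! ## §2 VSM outer loop (closed quasi-statically) ↦ `Models.SMIB` -/

namespace InverterVSM.VsmOuterLoop

variable (V : InverterVSM.VsmOuterLoop)

/-- Model-1's SMIB record equivalent to the VSM (2.59a)–(2.59b) closed with `p_e = P_max sin θ`,
obtained through `toReduced` [cite: HenriquezAuba2022, eqs. (2.59a)–(2.59b) and Remark after
(2.9)]: in `Ω = Ω_b(ω − ω_s)` one gets `M_smib = M/Ω_b`, `D_smib = 1/(Ω_b k_p)`, `P_m = p*`,
`P_C = 0`, `P_M = P_max`, `γ = 0` (`toGridSMIB_M`, `toGridSMIB_D`). MODELLED: MV-6V. -/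
def toGridSMIB (Pmax : ℝ) : Models.SMIB := (V.toReduced Pmax).toGridSMIB

/-- Virtual inertia in the rad/s speed variable: `M_smib = M/Ω_b` (nonzero `M, k_p`). -/
theorem toGridSMIB_M (hM : V.M ≠ 0) (hk : V.kp ≠ 0) (Pmax : ℝ) :
    (V.toGridSMIB Pmax).M = V.M / V.Ωb := by
  simp only [toGridSMIB, InverterDroop.ReducedParams.toGridSMIB, toReduced]
  field_simp

/-- Damping of the equivalent SMIB record: `D_smib = 1/(Ω_b k_p)` — the frequency-droop gain. -/
theorem toGridSMIB_D (Pmax : ℝ) : (V.toGridSMIB Pmax).D = 1 / (V.Ωb * V.kp) := rfl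

/-- The remaining data: `P_m = p*`, `P_C = 0`, `P_M = P_max`, `γ = 0`. -/
theorem toGridSMIB_data (Pmax : ℝ) :
    (V.toGridSMIB Pmax).Pm = V.pref ∧ (V.toGridSMIB Pmax).PC = 0 ∧
      (V.toGridSMIB Pmax).PM = Pmax ∧ (V.toGridSMIB Pmax).γ = 0 :=
  ⟨rfl, rfl, rfl, rfl⟩

/-- **Solutions correspond (VSM).** Every solution `(θ, ω)` of the closed VSM model with
`ω* = ω_s` (set-point = grid frequency) and nonzero `Ω_b, M, k_p` is carried by
`(θ, ω) ↦ (θ, Ω_b(ω − ω_s))` to a solution of `V.toGridSMIB Pmax` on every time set. -/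
theorem isSolutionOn_toGridSMIB (hb : V.Ωb ≠ 0) (hM : V.M ≠ 0) (hk : V.kp ≠ 0)
    (hω : V.ωref = V.ωs) (Pmax : ℝ) {θ ω : ℝ → ℝ} (h : V.IsSolution Pmax θ ω) (s : Set ℝ) :
    (V.toGridSMIB Pmax).IsSolutionOn (fun t => (θ t, V.Ωb * (ω t - V.ωs))) s := by
  have h' : (V.toReduced Pmax).IsSolution θ ω := (V.isSolution_iff_toReduced hb hM hk Pmax θ ω).1 h
  have hi : (V.toReduced Pmax).ki ≠ 0 := mul_ne_zero hb hk
  have hc : (V.toReduced Pmax).ωc ≠ 0 := by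
    simp only [toReduced]
    exact one_div_ne_zero (mul_ne_zero hM hk)
  have := (V.toReduced Pmax).isSolutionOn_toGridSMIB hb hi hc hω h' s
  simpa [toGridSMIB, InverterDroop.ReducedParams.toGridState, toReduced] using this

/-- **Exact embedding lemma for the VSM (chain rule)**, through `toReduced`: with recast data
`a = (Ω_b/M) P_max cos θ^s`, `b = (Ω_b/M) P_max sin θ^s`, `d = 1/(M k_p)` (nonzero `M, k_p`), an
equilibrium angle `P_max sin θ^s = p*`, and `ω* = ω_s`, every VSM solution is carried to a curve
`z(t) = SMIB.embed θ^s (θ t, Ω_b(ω t − ω_s))` with `dz_k/dt = f_k(z(t))`,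
`f = SMIB.polyField a b d`. MODELLED: MV-6V. -/
theorem hasDerivWithinAt_embed (hb : V.Ωb ≠ 0) (hM : V.M ≠ 0) (hk : V.kp ≠ 0)
    (hω : V.ωref = V.ωs) (Pmax : ℝ) {a b d : ℚ} {θs : ℝ}
    (ha : (a : ℝ) = V.Ωb / V.M * Pmax * cos θs) (hb' : (b : ℝ) = V.Ωb / V.M * Pmax * sin θs)
    (hd : (d : ℝ) = 1 / (V.M * V.kp)) (hP : Pmax * sin θs = V.pref)
    {θ ω : ℝ → ℝ} (h : V.IsSolution Pmax θ ω) {s : Set ℝ} {t : ℝ} (ht : t ∈ s) (k : Fin 3) :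
    HasDerivWithinAt (fun τ => Models.SMIB.embed θs (θ τ, V.Ωb * (ω τ - V.ωs)) k)
      (((Models.SMIB.polyField a b d).getD k []).eval
        (Models.SMIB.embed θs (θ t, V.Ωb * (ω t - V.ωs)))) s t := by
  have h' : (V.toReduced Pmax).IsSolution θ ω := (V.isSolution_iff_toReduced hb hM hk Pmax θ ω).1 h
  have hi : (V.toReduced Pmax).ki ≠ 0 := mul_ne_zero hb hk
  have hc : (V.toReduced Pmax).ωc ≠ 0 := by
    simp only [toReduced]
    exact one_div_ne_zero (mul_ne_zero hM hk)
  have hgain : (V.toReduced Pmax).ki * (V.toReduced Pmax).ωc = V.Ωb / V.M := by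
    simp only [toReduced]
    field_simp
  have ha' : (a : ℝ) = (V.toReduced Pmax).ki * (V.toReduced Pmax).ωc * (V.toReduced Pmax).Pmax
      * cos θs := by rw [hgain, ha]; rfl
  have hb'' : (b : ℝ) = (V.toReduced Pmax).ki * (V.toReduced Pmax).ωc * (V.toReduced Pmax).Pmax
      * sin θs := by rw [hgain, hb']; rfl
  have hd' : (d : ℝ) = (V.toReduced Pmax).ωc := by rw [hd]; rfl
  have hP' : (V.toReduced Pmax).Pmax * sin θs = (V.toReduced Pmax).pref := hP
  have := (V.toReduced Pmax).hasDerivWithinAt_embed hb hi hc hω ha' hb'' hd' hP' h' ht k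
  simpa [InverterDroop.ReducedParams.toGridState, toReduced] using this

end InverterVSM.VsmOuterLoop

end Summit.Ventures.GridStability.Models

end
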